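import Mathlib
import Summits.NavierStokesRegularity.NavierStokesRegularity.Theorems.EulerZoomLiouvillePowerGaugeEulerLiouvilleWeakFlowJacobian
import Summits.NavierStokesRegularity.NavierStokesRegularity.Theorems.EulerZoomLiouvillePowerGaugeEulerLiouvilleWeakIntegrableVorticityTools
import Summits.NavierStokesRegularity.NavierStokesRegularity.Theorems.EulerZoomLiouvillePowerGaugeEulerLiouvilleSelfSimilarPastSubExtremal
import HarnessLib

/-!
# Crux `EulerZoomLiouville.PowerGaugeEulerLiouville` (stmt-NavierStokesRegularity-19832), weak stratum, line `weak_lagrangian` (ns-idea-11 g9, REV2):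
# CHAE'S SUPPORT LAW IN THE WEAK CLASS — `stub_supportLaw` (S6) filled

Route №10 `EulerZoomLiouville` (NavierStokesRegularity), crux E = stmt-NavierStokesRegularity-19832; width seat ns-ezl-w1 g8 under the LEAD ns-typeII-p2 g15.
Given the backward regular Lagrangian flow `Ψ` of `−W` with the exact Jacobian law `(Ψ_σ)_# vol = e^{3γσ} vol` and the Cauchy clause of Lagrangian Kelvin
(`ω(Ψ_σ y) = e^{(1+γ)σ} D_σ(y) ω(y)` a.e., `ω = curlCLM ∘ G`), a weak profile whose vorticity is supported on a set of FINITE VOLUME is trivial — for EVERY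
`ρ ∈ (0, ½]` (Chae 2007 Cor. 1, the `p → 0` endpoint, in a.e. binders):

* `volume_support_eq_zero_of_cauchy` — the a.e. Cauchy clause at one time `σ > 0` gives `Ψ_σ⁻¹ A ⊆ A` a.e. for the (measurable representative of the) vortical set
  `A`; the Jacobian law makes `vol(Ψ_σ⁻¹ A) = e^{3γσ} vol A`; with `vol A < ∞` and `e^{3γσ} > 1`, `vol A = 0`;
* `supportLaw` — `= Sig.stub_supportLaw` of the line with its reducible predicates δ-unfolded (fill by `exact WeakLagrangian.supportLaw …`): `curlCLM ∘ G = 0`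
  a.e. ⇒ `G` a.e. symmetric (`symm_of_curlCLM_eq_zero`) and trace-free (weak incompressibility), `A`-growth `∫_{B_r}‖V‖² ≤ C r^{1−2ρ}` (`Past.profileData_of_past`)
  ⇒ `V = 0` a.e. by the weak harmonic Liouville theorem `ae_eq_zero_of_symm_traceFree_of_growth` ⇒ the member is trivial (`Past.ae_eq_zero_of_profile_ae_eq_zero`).

WHAT THIS IS NOT: not NS, not E, not M1/M2 — the flow and the Cauchy clause are HYPOTHESES; 19832 is OPEN. [folklore; Chae2007 (arXiv:math/0601661) Cor. 1;
ChaeShvydkoy2013 §4 Thm 4.1 (endgame)]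
-/

noncomputable section

-- flat `Theorems/<Route><Decl>…` files of one crux share the namespace of the crux (tree convention)
set_option linter.dupNamespace false

open MeasureTheory Set Filter Topology Metric Function TopologicalSpace ContinuousLinearMap
open scoped ENNReal NNReal InnerProductSpace RealInnerProductSpace ContDiff

namespace Summit.NavierStokesRegularity.NavierStokesRegularity.Theorems.PowerGaugeEulerLiouville.WeakLagrangian

open Literature.Analysis Literature.Analysis.FunctionSpaces Literature.Analysis.FluidPDE
open Summit.NavierStokesRegularity.NavierStokesRegularity.Theorems.PowerGaugeEulerLiouville

section Support

variable {Ψ : ℝ → EuclideanSpace ℝ (Fin 3) → EuclideanSpace ℝ (Fin 3)} {J : ℝ → ℝ≥0∞}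

/-- **A backward-invariant set of finite volume under an expanding Jacobian is null.**  `Ψ_σ` measurable with `(Ψ_σ)_# vol = J • vol`, `1 < J < ∞`;
`A` measurable with `vol A < ∞` and `Ψ_σ⁻¹ A ⊆ A` up to a null set (`∀ᵐ y, Ψ_σ y ∈ A → y ∈ A`).  Then `vol A = 0`. [folklore; Chae2007 Cor. 1 (the volume argument)] -/
theorem volume_eq_zero_of_preimage_subset_ae (hΨm : Measurable (Function.uncurry Ψ)) {σ : ℝ}
    (hjac : Measure.map (Ψ σ) (volume : Measure (EuclideanSpace ℝ (Fin 3))) = J σ • (volume : Measure (EuclideanSpace ℝ (Fin 3))))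
    (hJ1 : 1 < J σ) (hJtop : J σ ≠ ⊤) {A : Set (EuclideanSpace ℝ (Fin 3))} (hA : MeasurableSet A) (hAfin : volume A ≠ ⊤)
    (hinv : ∀ᵐ y ∂(volume : Measure (EuclideanSpace ℝ (Fin 3))), Ψ σ y ∈ A → y ∈ A) :
    volume A = 0 := by
  have hmeas : Measurable (Ψ σ) := hΨm.of_uncurry_left
  have hpre : volume (Ψ σ ⁻¹' A) = J σ * volume A := by
    rw [← Measure.map_apply hmeas hA, hjac, Measure.smul_apply, smul_eq_mul]
  have hle : volume (Ψ σ ⁻¹' A) ≤ volume A := by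
    refine measure_mono_ae ?_
    filter_upwards [hinv] with y hy
    exact fun h => hy h
  rw [hpre] at hle
  by_contra hne
  have hm : 0 < (volume A).toReal := ENNReal.toReal_pos hne hAfin
  have h1 : (J σ).toReal * (volume A).toReal ≤ (volume A).toReal := by
    have := ENNReal.toReal_mono hAfin hle
    rwa [ENNReal.toReal_mul] at this
  have h2 : (J σ).toReal ≤ 1 := (mul_le_iff_le_one_left hm).1 h1
  have h3 : (1 : ℝ≥0∞).toReal < (J σ).toReal := (ENNReal.toReal_lt_toReal ENNReal.one_ne_top hJtop).2 hJ1
  rw [ENNReal.toReal_one] at h3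
  linarith

end Support

/-! ### The support law -/

section Member

variable {V : EuclideanSpace ℝ (Fin 3) → EuclideanSpace ℝ (Fin 3)}
  {G : EuclideanSpace ℝ (Fin 3) → EuclideanSpace ℝ (Fin 3) →L[ℝ] EuclideanSpace ℝ (Fin 3)}
  {Ψ : ℝ → EuclideanSpace ℝ (Fin 3) → EuclideanSpace ℝ (Fin 3)}
  {D : ℝ → EuclideanSpace ℝ (Fin 3) → (EuclideanSpace ℝ (Fin 3) →L[ℝ] EuclideanSpace ℝ (Fin 3))}

/-- **FINITE-VOLUME VORTICITY SUPPORT + CAUCHY CLAUSE + JACOBIAN LAW ⇒ THE VORTICITY VANISHES A.E.**  `G` a.e.-strongly measurable; `Ψ` jointly measurable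
with `(Ψ_σ)_# vol = e^{3γσ} vol` for `σ ≥ 0` (`γ > 0`); the Cauchy clause `curlCLM(G(Ψ_σ y)) = e^{(1+γ)σ} D_σ(y) curlCLM(G y)` a.e. for `σ ≥ 0`; and
`vol{curlCLM ∘ G ≠ 0} < ∞`.  Then `curlCLM (G y) = 0` for a.e. `y`. [folklore; Chae2007 Cor. 1] -/
theorem curlCLM_ae_eq_zero_of_finite_support {γ : ℝ} (hγ : 0 < γ) (hGm : AEStronglyMeasurable G volume)
    (hΨm : Measurable (Function.uncurry Ψ))
    (hjac : ∀ σ : ℝ, 0 ≤ σ →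
      Measure.map (Ψ σ) (volume : Measure (EuclideanSpace ℝ (Fin 3))) =
        ENNReal.ofReal (Real.exp (3 * γ * σ)) • (volume : Measure (EuclideanSpace ℝ (Fin 3))))
    (hcauchy : ∀ σ : ℝ, 0 ≤ σ → ∀ᵐ y ∂(volume : Measure (EuclideanSpace ℝ (Fin 3))),
      curlCLM (G (Ψ σ y)) = Real.exp ((1 + γ) * σ) • D σ y (curlCLM (G y)))
    (hfin : (volume : Measure (EuclideanSpace ℝ (Fin 3))) {y | curlCLM (G y) ≠ 0} < ⊤) :
    ∀ᵐ y ∂(volume : Measure (EuclideanSpace ℝ (Fin 3))), curlCLM (G y) = 0 := by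
  -- measurable representative of the vorticity
  have hwm : AEStronglyMeasurable (fun y => curlCLM (G y)) volume := curlCLM.continuous.comp_aestronglyMeasurable hGm
  set w' : EuclideanSpace ℝ (Fin 3) → EuclideanSpace ℝ (Fin 3) := hwm.mk _ with hw'
  have hw'm : Measurable w' := hwm.stronglyMeasurable_mk.measurable
  have hww' : (fun y => curlCLM (G y)) =ᵐ[volume] w' := hwm.ae_eq_mk
  set A : Set (EuclideanSpace ℝ (Fin 3)) := {y | w' y ≠ 0} with hAdef
  have hA : MeasurableSet A := (hw'm (measurableSet_singleton 0)).compl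
  -- `A` agrees a.e. with the support of the vorticity, hence has finite volume
  have hAeq : A =ᵐ[volume] ({y | curlCLM (G y) ≠ 0} : Set (EuclideanSpace ℝ (Fin 3))) := by
    filter_upwards [hww'] with y hy
    simp only [eq_iff_iff]
    change w' y ≠ 0 ↔ curlCLM (G y) ≠ 0
    rw [hy]
  have hAfin : volume A ≠ ⊤ := by rw [measure_congr hAeq]; exact hfin.ne
  -- backward invariance of `A` at time `σ = 1`
  have hJ := hjac 1 zero_le_one
  have hinv : ∀ᵐ y ∂(volume : Measure (EuclideanSpace ℝ (Fin 3))), Ψ 1 y ∈ A → y ∈ A := by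
    have h1 := hcauchy 1 zero_le_one
    have h2 : ∀ᵐ y ∂(volume : Measure (EuclideanSpace ℝ (Fin 3))), curlCLM (G (Ψ 1 y)) = w' (Ψ 1 y) :=
      ae_comp_slice (J := fun s => ENNReal.ofReal (Real.exp (3 * γ * s))) hΨm hJ hww'
    filter_upwards [h1, h2, hww'] with y hy1 hy2 hy3 hmem
    -- if `y ∉ A` then `w' y = 0`, so the Cauchy clause forces `w'(Ψ 1 y) = 0`
    by_contra hy
    have h0 : curlCLM (G y) = 0 := by
      rw [hy3]; by_contra h; exact hy h
    have h4 : w' (Ψ 1 y) = 0 := by rw [← hy2, hy1, h0, map_zero, smul_zero]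
    exact hmem h4
  have hvol : volume A = 0 :=
    volume_eq_zero_of_preimage_subset_ae (J := fun s => ENNReal.ofReal (Real.exp (3 * γ * s))) hΨm hJ
      (by
        rw [← ENNReal.ofReal_one]
        exact (ENNReal.ofReal_lt_ofReal_iff (Real.exp_pos _)).2 (by rw [mul_one]; exact Real.one_lt_exp_iff.2 (by positivity)))
      ENNReal.ofReal_ne_top hA hAfin hinv
  -- conclude
  have hA0 : ∀ᵐ y ∂(volume : Measure (EuclideanSpace ℝ (Fin 3))), y ∉ A := measure_eq_zero_iff_ae_notMem.1 hvol
  filter_upwards [hA0, hww'] with y hy hy'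
  rw [hy']
  by_contra h
  exact hy h

/-- **CHAE'S SUPPORT LAW IN THE WEAK CLASS** (= `Sig.stub_supportLaw` of `Lines/weak_lagrangian.lean` REV2 with `InClass`, `IsExactlySelfSimilar`, `IsProfileGradient`,
`IsBackwardFlow`, `HasLagrangianKelvin`, `transportW` δ-unfolded; EVERY `0 < ρ ≤ ½`): an exactly self-similar class member with profile gradient `G`, backward flow `Ψ`
(exact Jacobian law) and the Lagrangian Kelvin structure `D` (Cauchy clause), whose vorticity `curlCLM ∘ G` is supported on a set of finite volume, is trivial.
[folklore; Chae2007 (arXiv:math/0601661) Cor. 1] -/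
theorem supportLaw {ρ : ℝ} (hρ : 0 < ρ) (hρh : ρ ≤ 1 / 2)
    {u : ℝ → EuclideanSpace ℝ (Fin 3) → EuclideanSpace ℝ (Fin 3)} {p : ℝ → EuclideanSpace ℝ (Fin 3) → ℝ}
    {H : ℝ → EuclideanSpace ℝ (Fin 3) → EuclideanSpace ℝ (Fin 3) →L[ℝ] EuclideanSpace ℝ (Fin 3)} {c : ℝ≥0}
    {V : EuclideanSpace ℝ (Fin 3) → EuclideanSpace ℝ (Fin 3)} {P : EuclideanSpace ℝ (Fin 3) → ℝ}
    {G : EuclideanSpace ℝ (Fin 3) → EuclideanSpace ℝ (Fin 3) →L[ℝ] EuclideanSpace ℝ (Fin 3)}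
    {Ψ : ℝ → EuclideanSpace ℝ (Fin 3) → EuclideanSpace ℝ (Fin 3)}
    {D : ℝ → EuclideanSpace ℝ (Fin 3) → (EuclideanSpace ℝ (Fin 3) →L[ℝ] EuclideanSpace ℝ (Fin 3))}
    (hcls : IsSuitableWeakSolutionOn (slab (EuclideanSpace ℝ (Fin 3)) (Set.Iio 0) isOpen_Iio) 0 0 u p ∧
      HasWeakSpatialGradientOn (slab (EuclideanSpace ℝ (Fin 3)) (Set.Iio 0) isOpen_Iio) u H ∧
      (∀ a : ℝ, 0 < a →
        ENNReal.ofReal (a ^ (2 * ρ)) * cknA a (0 : ℝ × EuclideanSpace ℝ (Fin 3)) u +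
            ENNReal.ofReal (a ^ ρ) * cknE a (0 : ℝ × EuclideanSpace ℝ (Fin 3)) H +
          ENNReal.ofReal (a ^ (2 * ρ)) * cknD a (0 : ℝ × EuclideanSpace ℝ (Fin 3)) p ≤ (c : ℝ≥0∞)))
    (hss : (∀ τ : ℝ, τ < 0 → u τ = selfSimilarCollapse (1 / (2 + ρ)) 0 V τ) ∧
      (∀ τ : ℝ, τ < 0 → p τ = selfSimilarCollapsePressure (1 / (2 + ρ)) 0 P τ))
    (hPG : HasWeakFDerivOn (⊤ : Opens (EuclideanSpace ℝ (Fin 3))) volume V G ∧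
      (∀ r : ℝ, MemLp G 2 (volume.restrict (ball (0 : EuclideanSpace ℝ (Fin 3)) r))) ∧
      (∀ r : ℝ, MemLp V 6 (volume.restrict (ball (0 : EuclideanSpace ℝ (Fin 3)) r))) ∧
      HasWeakFDerivOn (⊤ : Opens (EuclideanSpace ℝ (Fin 3))) volume (selfSimilarTransport (1 / (2 + ρ)) 0 V)
        (fun x => (1 / (2 + ρ)) • ContinuousLinearMap.id ℝ (EuclideanSpace ℝ (Fin 3)) + G x))
    (hΨ : Measurable (Function.uncurry Ψ) ∧
      (∀ y : EuclideanSpace ℝ (Fin 3), Ψ 0 y = y) ∧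
      (∀ᵐ y ∂(volume : Measure (EuclideanSpace ℝ (Fin 3))), ∀ σ : ℝ, 0 ≤ σ →
        IntervalIntegrable (fun s => selfSimilarTransport (1 / (2 + ρ)) 0 V (Ψ s y)) volume 0 σ ∧
          Ψ σ y = y - ∫ s in (0 : ℝ)..σ, selfSimilarTransport (1 / (2 + ρ)) 0 V (Ψ s y)) ∧
      (∀ σ s : ℝ, 0 ≤ σ → 0 ≤ s → ∀ᵐ y ∂(volume : Measure (EuclideanSpace ℝ (Fin 3))), Ψ (σ + s) y = Ψ σ (Ψ s y)) ∧
      (∀ σ : ℝ, 0 ≤ σ →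
        Measure.map (Ψ σ) (volume : Measure (EuclideanSpace ℝ (Fin 3))) =
          ENNReal.ofReal (Real.exp (3 * (1 / (2 + ρ)) * σ)) • (volume : Measure (EuclideanSpace ℝ (Fin 3)))))
    (hK : (∀ᵐ y ∂(volume : Measure (EuclideanSpace ℝ (Fin 3))), D 0 y = ContinuousLinearMap.id ℝ (EuclideanSpace ℝ (Fin 3)) ∧ ∀ σ : ℝ, 0 ≤ σ →
        IntervalIntegrable (fun s => ((1 / (2 + ρ)) • ContinuousLinearMap.id ℝ (EuclideanSpace ℝ (Fin 3)) + G (Ψ s y)).comp (D s y)) volume 0 σ ∧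
          D σ y = ContinuousLinearMap.id ℝ (EuclideanSpace ℝ (Fin 3)) -
            ∫ s in (0 : ℝ)..σ, ((1 / (2 + ρ)) • ContinuousLinearMap.id ℝ (EuclideanSpace ℝ (Fin 3)) + G (Ψ s y)).comp (D s y)) ∧
      (∀ σ : ℝ, 0 ≤ σ → ∀ᵐ y ∂(volume : Measure (EuclideanSpace ℝ (Fin 3))),
        curlCLM (G (Ψ σ y)) = Real.exp ((1 + 1 / (2 + ρ)) * σ) • D σ y (curlCLM (G y))))
    (hfin : (volume : Measure (EuclideanSpace ℝ (Fin 3))) {y : EuclideanSpace ℝ (Fin 3) | curlCLM (G y) ≠ 0} < ⊤) :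
    Function.uncurry u =ᵐ[volume.restrict (Set.Iio (0 : ℝ) ×ˢ (Set.univ : Set (EuclideanSpace ℝ (Fin 3))))] 0 := by
  obtain ⟨hsw, hH, hgauge⟩ := hcls
  obtain ⟨hu, hp⟩ := hss
  obtain ⟨hVG, -, -, -⟩ := hPG
  obtain ⟨hΨm, -, -, -, hjac⟩ := hΨ
  obtain ⟨-, hcauchy⟩ := hK
  -- ### class data
  have hA : ∀ a : ℝ, 0 < a → ENNReal.ofReal (a ^ (2 * ρ)) *
      cknA a (0 : ℝ × EuclideanSpace ℝ (Fin 3)) u ≤ (c : ℝ≥0∞) :=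
    fun a ha => le_trans (le_trans le_self_add le_self_add) (hgauge a ha)
  have hE : ∀ a : ℝ, 0 < a → ENNReal.ofReal (a ^ ρ) *
      cknE a (0 : ℝ × EuclideanSpace ℝ (Fin 3)) H ≤ (c : ℝ≥0∞) :=
    fun a ha => le_trans (le_trans le_add_self le_self_add) (hgauge a ha)
  have hD : ∀ a : ℝ, 0 < a → ENNReal.ofReal (a ^ (2 * ρ)) *
      cknD a (0 : ℝ × EuclideanSpace ℝ (Fin 3)) p ≤ (c : ℝ≥0∞) :=
    fun a ha => le_trans le_add_self (hgauge a ha)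
  have hu' : ∀ τ : ℝ, τ < 0 → u τ = fun x => selfSimilarCollapse (1 / (2 + ρ)) 0 V τ (x - 0) :=
    fun τ hτ => by rw [hu τ hτ]; funext x; rw [sub_zero]
  have hp' : ∀ τ : ℝ, τ < 0 → p τ = fun x => selfSimilarCollapsePressure (1 / (2 + ρ)) 0 P τ (x - 0) :=
    fun τ hτ => by rw [hp τ hτ]; funext x; rw [sub_zero]
  obtain ⟨G', hVm, -, -, -, -, ⟨CA, hCA, hAgr⟩, -, -, -, -, -, hdivV, -, -, -⟩ :=
    Past.profileData_of_past hρ hρh le_rfl le_rfl 0 hsw.distributional hH hA hE hD hu' hp'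
  have hGl : LocallyIntegrable G volume := locallyIntegrableOn_univ.1 (by
    simpa only [Opens.coe_top] using hVG.locallyIntegrableOn_deriv)
  have hGm : AEStronglyMeasurable G volume := hGl.aestronglyMeasurable
  -- ### the vorticity vanishes a.e.
  have hγ : (0 : ℝ) < 1 / (2 + ρ) := by positivity
  have hcurl : ∀ᵐ y ∂(volume : Measure (EuclideanSpace ℝ (Fin 3))), curlCLM (G y) = 0 :=
    curlCLM_ae_eq_zero_of_finite_support hγ hGm hΨm hjac hcauchy hfin
  -- ### symmetric, trace-free weak gradient with `A`-growth ⇒ `V = 0` a.e.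
  have hsym : ∀ᵐ x ∂(volume : Measure (EuclideanSpace ℝ (Fin 3))), ∀ v w : EuclideanSpace ℝ (Fin 3), ⟪G x v, w⟫ = ⟪G x w, v⟫ := by
    filter_upwards [hcurl] with x hx
    exact WeakConfinedVorticity.symm_of_curlCLM_eq_zero hx
  have htr : ∀ᵐ x ∂(volume : Measure (EuclideanSpace ℝ (Fin 3))), ∑ j, G x (EuclideanSpace.single j (1 : ℝ)) j = 0 := by
    filter_upwards [hdivV.trace_weakGradient_ae_eq_zero hVG] with x hx
    rw [LinearMap.trace_eq_sum_inner _ (EuclideanSpace.basisFun (Fin 3) ℝ)] at hx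
    simpa [EuclideanSpace.basisFun_apply, EuclideanSpace.inner_single_left] using hx
  have hgrowth : ∀ r : ℝ, 2 < r → 0 < r →
      ∫⁻ x in ball (0 : EuclideanSpace ℝ (Fin 3)) r, ‖V x‖ₑ ^ 2 ≤ ENNReal.ofReal (CA.toReal * r ^ (1 - 2 * ρ)) := by
    intro r hr _
    rw [ENNReal.ofReal_mul ENNReal.toReal_nonneg, ENNReal.ofReal_toReal hCA]
    exact hAgr r (by linarith)
  have hV0 : V =ᵐ[volume] 0 :=
    ae_eq_zero_of_symm_traceFree_of_growth hVG hsym htr (K := CA.toReal) (m := 1 - 2 * ρ) (r₀ := 2) (by linarith) hgrowth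
  -- ### the member is trivial
  exact Past.ae_eq_zero_of_profile_ae_eq_zero (γ := 1 / (2 + ρ)) hρ.le le_rfl hsw hH hgauge hu' hV0

end Member

end Summit.NavierStokesRegularity.NavierStokesRegularity.Theorems.PowerGaugeEulerLiouville.WeakLagrangian

end
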